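import Summits.BirchSwinnertonDyer.BirchSwinnertonDyer.Theorems.CyclotomicUntwistEigensymbolCharValues
import Summits.BirchSwinnertonDyer.BirchSwinnertonDyer.Theorems.CyclotomicUntwistGammaUniqueness
import HarnessLib


/-!
# Untwist eigensymbols, III: EXISTENCE of the untwisted `p`-adic `L`-function (D1) from an untwist
# eigensymbol — the Mazur–Tate–Teitelbaum construction in the ball-value currency of `IsUntwistedPAdicLFunction`

Cell `pub/bsd-wall` (D-0145 line `route-BirchSwinnertonDyer-CyclotomicUntwist`), seat `bsd-line-cycu-p3`
(prover seat 3/3), helper toward crux K1 `PSRankOneLowerHalfAtThree` (stmt-BirchSwinnertonDyer-21580) —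
precisely toward its EXISTENCE want F1 (`wi-84943`: "`∃ 𝓛, IsPSCyclotomicLFunctionOf W η α 𝓛`").  Third of
three files (`…EigensymbolPushforward` §1–§3 → `…EigensymbolCharValues` §4–§5 → this file §6).
THEOREMS ONLY (no definition, no named fact, no `sorry`). BSD is not proved by this file and no crux of
the route is proved by it.

WHAT. The route's definition item D1 (`Literature.NumberTheory.IwasawaTheory.IsUntwistedPAdicLFunction p f η α μ`,
file `Literature/NumberTheory/IwasawaTheory/PSCyclotomicLFunction.lean`) types the cyclotomic `p`-adic
`L`-function of the UNTWIST `g` (newform of `f ⊗ η̄`, `U_p g = α g`, `p ∣ N_g`) as an additive system of ball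
values on `Γ = 1 + p^{e₀}ℤ_p` of growth order `½` with a prescribed value at EVERY finite-order character of
`Γ`, written in the rational plus symbols `[r]⁺_f` of `f`; uniqueness is the tree's
`PSGammaUniqueness.eq_of_isUntwistedPAdicLFunction`.  This file proves EXISTENCE from the datum the
printed construction actually uses — an UNTWIST EIGENSYMBOL: a function `Φ : ℚ → ℂ_p` (intended:
`r ↦ τ(η) {∞, r}⁺_g / Ω⁺_f`, the plus modular symbol of `g` in the period of `f`) with

* (S1) `Φ (r + k) = Φ r` for `k ∈ ℤ` (translation invariance, `T ∈ Γ₁(N_g)`);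
* (S2) `∑_{j mod p} Φ ((r + j)/p) = α Φ r` (`U_p g = α g`, MTT §I.4 (4.2) with `ε(p) = 0`);
* (S3) `Φ r − (α/p) Φ (p r) = ∑_{b mod p^c} η(b) [r + b/p^c]⁺_f` (the `p`-DEPRIVATION identity
  `g − α g(p·) = f ⊗ η̄` of the module docstring of D1: `{∞,r}_{g(p·)} = p⁻¹{∞, pr}_g` and Shimura 3.64
  `τ(η){∞,r}_{f⊗η̄} = ∑_b η(b){∞, r + b/p^c}_f`, `modularSymbol_charTwist`);
* (S4) `‖Φ r‖ ≤ C` (bounded denominators of the symbols of `g`, Manin–Drinfeld);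

— all four asked only at the points `r = a/pⁿ` (`a : ℤ`) of `ℤ[1/p]`, the only points the construction
evaluates — together with `‖α⁻¹‖ ≤ √p` (slope `≤ ½`) and `α ≠ 0, p`.  From (S1)–(S2) the MTT ball values
`ν(a + p^L ℤ_p) = α^{-L} Φ(a/p^L)` form a distribution on `ℤ_p` (§1); their `η̄`-twisted push-forward to
`Γ` along `x ↦ ⟨x⟩` — level-`n` ball `γ^s Γ^{pⁿ}` ↦ the sum of `η(b)⁻¹ ν(b + p^{n+e₀+c}ℤ_p)` over the classes
`b mod p^{n+e₀+c}` reducing to a Teichmüller class `ζ γ^s mod p^{n+e₀}` (tree `classOf`) — is additive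
(§2), has growth order `½` by (S4) (§3), and (§4) its value at a character `ξ` of `Γ` is
`∑_{u ∈ (ℤ/p^M)^×} ξ(u) η(u)⁻¹ ν(u)` (the classes `ζ γ^s` run over the units exactly once, tree
`finsum_sum_classes_eq_sum_units`; `ξ(ζ) = 1`, tree `apply_toZModPow_rootsOfUnity`), which the
distribution relation moves to the level `pⁿ` of the primitive character `χ` of `η̄ξ`, where (S1)–(S3)
and the vanishing of coset sums of a primitive character (tree `sum_fiber_eq_zero_of_not_factorsThrough`)
evaluate it as `α^{-n} ∑_a ∑_b χ(a) η(b) [a/pⁿ + b/p^c]⁺_f = e_n(α) · untwistSymbolSum` for `n ≥ 1`, and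
as `(1 − α⁻¹) Φ(0) = (1 − α⁻¹)(1 − α/p)⁻¹ ∑_b η(b)[b/p^c]⁺_f = e_0(α) · untwistSymbolSum` at `ξ = 𝟙`
(§5).  Main statements (this file, §6): `isUntwistedPAdicLFunction_of_eigensymbol`,
`exists_isUntwistedPAdicLFunction_of_eigensymbol`, the EXPLICIT FORMULA
`eq_pushforward_of_isUntwistedPAdicLFunction` (with the tree's uniqueness
`PSGammaUniqueness.eq_of_isUntwistedPAdicLFunction`: D1 names exactly this object), and the W-level
`exists_isPSCyclotomicLFunctionOf_of_eigensymbol`.  The constructed system is written as a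
HYPOTHESIS-EQUATION (`hν`, `hL`) on function variables, the tree's idiom for a construction without a
`def` (`PAdicMeasureTransform`).

WHY (route bookkeeping). The want F1 was filed blocked «no faithful W-level fact typeable without a
Γ₁-symbol definition layer» (evidence `wi-84943-analysis.md`).  With this file the Γ₁-side input is
reduced to the four displayed axioms (S1)–(S4) on a bare function `ℚ → ℂ_p` — exactly the input of
Bellaïche's Thm. 6.7.9 / MTT §I.14 ("`p ∣ N`, `a_p ≠ 0`, one allowable root") — so F1 can be typed
W-level in EXISTING vocabulary; and the route's typed closers (`…FiniteSlopeShadowTyped`, `…KatoTyped`,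
`…WanTyped`, `…Separated`), all of which quantify `∃ η α 𝓛, IsPSCyclotomicLFunctionOf W η α 𝓛 ∧ …`,
receive their `𝓛` from a symbol.  Mathematics: Mazur–Tate–Teitelbaum 1986 §I.10 (the distribution of
an allowable root), §I.11, §I.13 (push-forward to `Γ`), §I.14 (case `p ∣ N`); Bellaïche 2021 §6.7.2–6.7.3
and Thm. 6.7.9; the templates are the tree's `PAdicLFunctionInterpolationProofs` (good ordinary `p`)
and `PAdicMeasureTransform` (abstract distributions).

References: [cite: MazurTateTeitelbaum1986Invent, §I.10–§I.11, §I.13–§I.14] · [cite: Bellaiche2021, §6.7.2–§6.7.3, Thm. 6.7.9].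
-/

noncomputable section

open Finset
open Literature.NumberTheory.EllipticCurves Literature.NumberTheory.EllipticCurves.ModularForms
  Literature.NumberTheory.IwasawaTheory

-- single-conjunct summit: `Summit.BirchSwinnertonDyer.BirchSwinnertonDyer.…` repeats the name by design
set_option linter.dupNamespace false

namespace Summit.BirchSwinnertonDyer.BirchSwinnertonDyer.Theorems.PSUntwistExistence

variable {p : ℕ} [Fact p.Prime]

variable {α : ℂ_[p]} {Φ : ℚ → ℂ_[p]} {ν : (n : ℕ) → ZMod (p ^ n) → ℂ_[p]}
  {c : ℕ} {η : DirichletCharacter ℂ_[p] (p ^ c)} {L : (n : ℕ) → ZMod (p ^ n) → ℂ_[p]}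

/-! ### §5½ The symbol hypotheses restricted to `ℤ[1/p]`

The construction only evaluates `Φ` at the points `a/pⁿ` (`a : ℤ`) of `ℤ[1/p]`; the lemmas of file I that
took (S2)/(S4) at every rational are re-derived here from the restricted forms, so that the main theorem
asks for (S1)–(S4) on `ℤ[1/p]` only (where the canonical `g`-free eigensymbol lives). -/

/-- `sum_fiber_symbolMeasure_succ` of file I with the `U_p`-eigen relation (S2) assumed only at the points
`a/pⁿ`, `a : ℤ` (that is all its proof uses). [cite: MazurTateTeitelbaum1986Invent, §I.10 Prop. (10.2)] -/
theorem sum_fiber_symbolMeasure_succ'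
    (heig : ∀ (n : ℕ) (a : ℤ), ∑ j : Fin p, Φ (((a : ℚ) / (p : ℚ) ^ n + j) / p) = α * Φ ((a : ℚ) / (p : ℚ) ^ n))
    (hα : α ≠ 0) (hν : ∀ (L : ℕ) (a : ZMod (p ^ L)), ν L a = α⁻¹ ^ L * Φ ((a.val : ℚ) / (p : ℚ) ^ L))
    (n : ℕ) (a : ZMod (p ^ n)) :
    ∑ b ∈ univ.filter (fun b : ZMod (p ^ (n + 1)) ↦
        ZMod.castHom (pow_dvd_pow p n.le_succ) (ZMod (p ^ n)) b = a), ν (n + 1) b = ν n a := by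
  classical
  have hp : p.Prime := Fact.out
  have hp0 : (p : ℚ) ≠ 0 := by exact_mod_cast hp.ne_zero
  have hinj : Function.Injective
      (fun j : Fin p ↦ ((a.val + p ^ n * (j : ℕ) : ℕ) : ZMod (p ^ (n + 1)))) := by
    intro j j' h
    have hv := congr_arg ZMod.val h
    simp only [val_classLift] at hv
    exact Fin.ext (Nat.eq_of_mul_eq_mul_left (pow_pos hp.pos n) (by omega))
  rw [filter_castHom_eq_image, Finset.sum_image fun j _ j' _ h ↦ hinj h]
  set x : ℚ := (a.val : ℚ) / (p : ℚ) ^ n with hx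
  have hA : ∀ j : Fin p, ((a.val + p ^ n * (j : ℕ) : ℕ) : ℚ) / (p : ℚ) ^ (n + 1) = (x + j) / p := by
    intro j
    rw [hx]
    push_cast
    field_simp
    ring
  have heigx : ∑ j : Fin p, Φ ((x + j) / p) = α * Φ x := by
    have h := heig n (a.val : ℕ)
    simp only [Int.cast_natCast] at h
    exact h
  simp only [hν, val_classLift, hA, ← Finset.mul_sum, heigx]
  rw [pow_succ, mul_assoc, inv_mul_cancel_left₀ hα]

/-- `norm_symbolMeasure_le` of file I with the bound (S4) assumed only on `ℤ[1/p]`: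
`‖α^{-L} Φ(a/p^L)‖ ≤ C p^{L/2}` for `‖α⁻¹‖ ≤ p^{1/2}`. [cite: MazurTateTeitelbaum1986Invent, §I.11] -/
theorem norm_symbolMeasure_le' {C : ℝ} (hbd : ∀ (n : ℕ) (a : ℤ), ‖Φ ((a : ℚ) / (p : ℚ) ^ n)‖ ≤ C)
    (hαn : ‖α⁻¹‖ ≤ (p : ℝ) ^ (1 / 2 : ℝ))
    (hν : ∀ (L : ℕ) (a : ZMod (p ^ L)), ν L a = α⁻¹ ^ L * Φ ((a.val : ℚ) / (p : ℚ) ^ L))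
    (L : ℕ) (a : ZMod (p ^ L)) : ‖ν L a‖ ≤ C * (p : ℝ) ^ ((1 / 2 : ℝ) * L) := by
  have hp0 : (0 : ℝ) < p := by exact_mod_cast (Fact.out : p.Prime).pos
  have hC0 : 0 ≤ C := (norm_nonneg _).trans (by simpa using hbd 0 0)
  have hb : ‖Φ ((a.val : ℚ) / (p : ℚ) ^ L)‖ ≤ C := by
    have h := hbd L (a.val : ℕ)
    simp only [Int.cast_natCast] at h
    exact h
  rw [hν, norm_mul, norm_pow, mul_comm]
  refine mul_le_mul hb ?_ (by positivity) hC0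
  calc ‖α⁻¹‖ ^ L ≤ ((p : ℝ) ^ (1 / 2 : ℝ)) ^ L := pow_le_pow_left₀ (norm_nonneg _) hαn L
    _ = (p : ℝ) ^ ((1 / 2 : ℝ) * L) := by rw [← Real.rpow_natCast, ← Real.rpow_mul hp0.le]

/-- `hasGrowthOrder_pushforward` of file I from a bound on the `ℤ_p`-ball values directly: if
`‖ν(a + p^Lℤ_p)‖ ≤ C p^{L/2}` for all `L`, `a`, the twisted push-forward has `HasGrowthOrder p (1/2)`
(ultrametric inequality; `‖η(b)⁻¹‖ ≤ 1`). [cite: Bellaiche2021, Def. 6.2.10] [cite: MazurTateTeitelbaum1986Invent, §I.11] -/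
theorem hasGrowthOrder_pushforward_of_norm_le {C : ℝ}
    (hνb : ∀ (L : ℕ) (a : ZMod (p ^ L)), ‖ν L a‖ ≤ C * (p : ℝ) ^ ((1 / 2 : ℝ) * L))
    (hL : ∀ (n : ℕ) (s : ZMod (p ^ n)), L n s =
      ∑ᶠ ζ : rootsOfUnity (torsionOrder p) ℤ_[p],
        ∑ b ∈ univ.filter (fun b : ZMod (p ^ (n + cyclotomicExponent p + c)) ↦
          ZMod.castHom (pow_dvd_pow p (Nat.le_add_right _ c)) (ZMod (p ^ (n + cyclotomicExponent p))) b =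
            classOf p n ζ s),
          (η (ZMod.castHom (pow_dvd_pow p (Nat.le_add_left c _)) (ZMod (p ^ c)) b))⁻¹ *
            ν (n + cyclotomicExponent p + c) b) :
    HasGrowthOrder p (1 / 2) L := by
  classical
  haveI := neZero_torsionOrder p
  haveI := Fintype.ofFinite (rootsOfUnity (torsionOrder p) ℤ_[p])
  have hp0 : (0 : ℝ) < p := by exact_mod_cast (Fact.out : p.Prime).pos
  have hC0 : 0 ≤ C := by
    have h := hνb 0 0
    simp only [CharP.cast_eq_zero, mul_zero, Real.rpow_zero, mul_one] at h
    exact (norm_nonneg _).trans h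
  refine ⟨C * (p : ℝ) ^ ((1 / 2 : ℝ) * (cyclotomicExponent p + c : ℕ)), fun n s ↦ ?_⟩
  have hK : C * (p : ℝ) ^ ((1 / 2 : ℝ) * (cyclotomicExponent p + c : ℕ)) * (p : ℝ) ^ ((1 / 2 : ℝ) * n) =
      C * (p : ℝ) ^ ((1 / 2 : ℝ) * (n + cyclotomicExponent p + c : ℕ)) := by
    rw [mul_assoc, ← Real.rpow_add hp0]
    push_cast
    ring_nf
  rw [hK, hL, finsum_eq_sum_of_fintype]
  refine IsUltrametricDist.norm_sum_le_of_forall_le_of_nonneg (by positivity) fun ζ _ ↦ ?_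
  refine IsUltrametricDist.norm_sum_le_of_forall_le_of_nonneg (by positivity) fun b _ ↦ ?_
  rw [norm_mul]
  calc _ ≤ 1 * (C * (p : ℝ) ^ ((1 / 2 : ℝ) * (n + cyclotomicExponent p + c : ℕ))) :=
        mul_le_mul (norm_inv_apply_le_one η _) (hνb _ b) (norm_nonneg _) zero_le_one
    _ = _ := one_mul _

/-! ### §6 Assembly: an untwist eigensymbol gives the untwisted `p`-adic `L`-function -/

/-- **MAIN THEOREM (existence of the D1 object from an untwist eigensymbol).**  Let `f` be a weight-`2`
cusp form on `Γ₀(N)`, `η` a Dirichlet character mod `p^c` with values in `ℂ_p`, `α ∈ ℂ_p` with `α ≠ 0`,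
`α ≠ p`, `‖α⁻¹‖ ≤ √p`, and `Φ : ℚ → ℂ_p` an untwist eigensymbol for `(f, η, α)` — (S1) `ℤ`-periodic,
(S2) `U_p Φ = α Φ`, (S3) `Φ(r) − (α/p)Φ(pr) = ∑_{b mod p^c} η(b) [r + b/p^c]⁺_f`, (S4) bounded.  Then the
`η̄`-twisted push-forward `L` to `Γ` (hypothesis-equations `hν`, `hL`) of the Mazur–Tate–Teitelbaum ball
values `α^{-L}Φ(a/p^L)` satisfies `IsUntwistedPAdicLFunction p f η α L`: it is additive
(`isGammaDistribution_pushforward`), of growth order `½` (`hasGrowthOrder_pushforward`), and takes the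
prescribed value at EVERY character `ξ` of `Γ` (incl. `ξ = 𝟙`): `gammaCharValue_pushforward` moves the
value to `∑_{u ∈ (ℤ/p^K)^×} ξ(u)η(u)⁻¹ν(u)`, the distribution relation to the level `pⁿ` of the primitive `χ`
of `η̄ξ` (after identifying the weight with `χ(u)` on units through `hχ`), and
`sum_mul_symbolMeasure_succ` / `sum_units_symbolMeasure_level_one` evaluate it.  This is the construction
of Mazur–Tate–Teitelbaum 1986 §I.10–§I.14 (case `p ∣ N`, `a_p ≠ 0`) = Bellaïche Thm. 6.7.9, transported by
`Tw_η` (D1 docstring); with the tree's uniqueness `PSGammaUniqueness.eq_of_isUntwistedPAdicLFunction` the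
D1 predicate names EXACTLY this object.
[cite: MazurTateTeitelbaum1986Invent, §I.10–§I.11 and §I.13–§I.14] [cite: Bellaiche2021, Thm. 6.7.9] -/
theorem isUntwistedPAdicLFunction_of_eigensymbol {N : ℕ} (f : CuspForm (CongruenceSubgroup.Gamma0 N) 2)
    (hα : α ≠ 0) (hαp : α ≠ p) (hαn : ‖α⁻¹‖ ≤ (p : ℝ) ^ (1 / 2 : ℝ))
    (hper : ∀ (n : ℕ) (a z : ℤ), Φ ((a : ℚ) / (p : ℚ) ^ n + z) = Φ ((a : ℚ) / (p : ℚ) ^ n))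
    (heig : ∀ (n : ℕ) (a : ℤ), ∑ j : Fin p, Φ (((a : ℚ) / (p : ℚ) ^ n + j) / p) = α * Φ ((a : ℚ) / (p : ℚ) ^ n))
    (hdep : ∀ (n : ℕ) (a : ℤ), Φ ((a : ℚ) / (p : ℚ) ^ n) - α / p * Φ (p * ((a : ℚ) / (p : ℚ) ^ n)) =
      ∑ b : ZMod (p ^ c), η b *
        algebraMap ℚ ℂ_[p] (ratPlusSymbol f ((a : ℚ) / (p : ℚ) ^ n + (b.val : ℚ) / (p : ℚ) ^ c)))
    (hbd : ∃ C : ℝ, ∀ (n : ℕ) (a : ℤ), ‖Φ ((a : ℚ) / (p : ℚ) ^ n)‖ ≤ C)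
    (hν : ∀ (L : ℕ) (a : ZMod (p ^ L)), ν L a = α⁻¹ ^ L * Φ ((a.val : ℚ) / (p : ℚ) ^ L))
    (hL : ∀ (n : ℕ) (s : ZMod (p ^ n)), L n s =
      ∑ᶠ ζ : rootsOfUnity (torsionOrder p) ℤ_[p],
        ∑ b ∈ univ.filter (fun b : ZMod (p ^ (n + cyclotomicExponent p + c)) ↦
          ZMod.castHom (pow_dvd_pow p (Nat.le_add_right _ c)) (ZMod (p ^ (n + cyclotomicExponent p))) b =
            classOf p n ζ s),
          (η (ZMod.castHom (pow_dvd_pow p (Nat.le_add_left c _)) (ZMod (p ^ c)) b))⁻¹ *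
            ν (n + cyclotomicExponent p + c) b) :
    IsUntwistedPAdicLFunction p f η α L := by
  classical
  have hdist := sum_fiber_symbolMeasure_succ' heig hα hν
  refine ⟨isGammaDistribution_pushforward hdist hL, ?_, ?_⟩
  · obtain ⟨C, hC⟩ := hbd
    exact hasGrowthOrder_pushforward_of_norm_le (norm_symbolMeasure_le' hC hαn hν) hL
  intro m ξ _hξ heven hord n χ hχ hχη
  rw [gammaCharValue_pushforward hL ξ heven hord]
  have h1K : 1 ≤ m + cyclotomicExponent p + c := by
    have := cyclotomicExponent_ne_zero p; omega
  have hmK : m ≤ m + cyclotomicExponent p + c := by omega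
  have hcK : c ≤ m + cyclotomicExponent p + c := Nat.le_add_left c _
  haveI : NeZero (p ^ (m + cyclotomicExponent p + c)) := ⟨pow_ne_zero _ (Fact.out : p.Prime).ne_zero⟩
  -- reorder the summands as `ν(u) · weight(u)`
  rw [show (∑ u : (ZMod (p ^ (m + cyclotomicExponent p + c)))ˣ,
      ξ (ZMod.castHom (pow_dvd_pow p hmK) (ZMod (p ^ m)) (u : ZMod (p ^ (m + cyclotomicExponent p + c)))) *
        ((η (ZMod.castHom (pow_dvd_pow p hcK) (ZMod (p ^ c))
            (u : ZMod (p ^ (m + cyclotomicExponent p + c)))))⁻¹ *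
          ν (m + cyclotomicExponent p + c) u)) =
      ∑ u : (ZMod (p ^ (m + cyclotomicExponent p + c)))ˣ, ν (m + cyclotomicExponent p + c) u *
        (ξ (ZMod.castHom (pow_dvd_pow p hmK) (ZMod (p ^ m)) (u : ZMod (p ^ (m + cyclotomicExponent p + c)))) *
          (η (ZMod.castHom (pow_dvd_pow p hcK) (ZMod (p ^ c))
            (u : ZMod (p ^ (m + cyclotomicExponent p + c)))))⁻¹) from
    Finset.sum_congr rfl fun u _ ↦ by ring]
  -- on units, at any level above `m`, `c` and `n`, the weight `ξ(u) η(u)⁻¹` is `χ(u)`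
  have hw : ∀ {K' : ℕ} (hK'm : m ≤ K') (hK'c : c ≤ K') (hn : n ≤ K') (hK'1 : 1 ≤ K')
      (u : (ZMod (p ^ K'))ˣ),
      ξ (ZMod.castHom (pow_dvd_pow p hK'm) (ZMod (p ^ m)) (u : ZMod (p ^ K'))) *
          (η (ZMod.castHom (pow_dvd_pow p hK'c) (ZMod (p ^ c)) (u : ZMod (p ^ K'))))⁻¹ =
        χ (ZMod.castHom (pow_dvd_pow p hn) (ZMod (p ^ n)) (u : ZMod (p ^ K'))) := by
    intro K' hK'm hK'c hn hK'1 u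
    rw [castHom_units_eq_natCast_val hK'm u, castHom_units_eq_natCast_val hK'c u,
      castHom_units_eq_natCast_val hn u, hχη _ (coprime_val_units hK'1 u), mul_comm]
  rcases n with _ | k
  · -- `χ` (mod `p⁰`) is trivial: the value is the total mass of the units
    have hsub : Subsingleton (ZMod (p ^ 0)) := by rw [pow_zero]; infer_instance
    have hχ1 : ∀ x : ZMod (p ^ 0), χ x = 1 := fun x ↦ by
      rw [Subsingleton.elim x 1, map_one]
    have hdown := sum_units_mul_of_distribution' hdist le_rfl h1K (fun _ : ZMod (p ^ 1) ↦ (1 : ℂ_[p]))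
    simp only [mul_one] at hdown
    rw [Finset.sum_congr rfl fun u _ ↦ by rw [hw hmK hcK (Nat.zero_le _) h1K u, hχ1, mul_one], hdown,
      sum_units_symbolMeasure_level_one hdist hν, untwistMultiplier_zero_mul_untwistSymbolSum f hαp hdep χ]
  · -- go up to a level divisible by the conductor `p^{k+1}` of `χ`, then down to it
    have hup := sum_units_mul_of_distribution' hdist h1K (Nat.le_add_right _ (k + 1))
      (fun a : ZMod (p ^ (m + cyclotomicExponent p + c)) ↦
        ξ (ZMod.castHom (pow_dvd_pow p hmK) (ZMod (p ^ m)) a) *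
          (η (ZMod.castHom (pow_dvd_pow p hcK) (ZMod (p ^ c)) a))⁻¹)
    rw [← hup, Finset.sum_congr rfl fun u _ ↦ by
      rw [castHom_castHom_zmod, castHom_castHom_zmod,
        hw (hmK.trans (Nat.le_add_right _ (k + 1))) (hcK.trans (Nat.le_add_right _ (k + 1)))
          (Nat.le_add_left (k + 1) _) (h1K.trans (Nat.le_add_right _ (k + 1))) u]]
    have hdown := sum_units_mul_of_distribution' hdist (Nat.succ_pos k)
      (Nat.le_add_left (k + 1) (m + cyclotomicExponent p + c)) (fun a : ZMod (p ^ (k + 1)) ↦ χ a)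
    rw [hdown]
    haveI : NeZero (p ^ (k + 1)) := ⟨pow_ne_zero _ (Fact.out : p.Prime).ne_zero⟩
    rw [sum_units_eq_sum_filter_isUnit (F := fun a : ZMod (p ^ (k + 1)) ↦ ν (k + 1) a * χ a),
      Finset.sum_filter, ← sum_mul_symbolMeasure_succ f hper hdep hν k χ hχ]
    refine Finset.sum_congr rfl fun a _ ↦ ?_
    split_ifs with ha
    · exact mul_comm _ _
    · rw [MulChar.map_nonunit χ ha, zero_mul]

/-- **EXISTENCE of the untwisted `p`-adic `L`-function from an untwist eigensymbol** (the `∃`-form of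
`isUntwistedPAdicLFunction_of_eigensymbol`, with the Mazur–Tate–Teitelbaum ball values and their twisted
push-forward written out as the witness): for `α ≠ 0, p` with `‖α⁻¹‖ ≤ √p` and `Φ` satisfying (S1)–(S4),
`∃ μ, IsUntwistedPAdicLFunction p f η α μ`. [cite: MazurTateTeitelbaum1986Invent, §I.10–§I.14] [cite: Bellaiche2021, Thm. 6.7.9] -/
theorem exists_isUntwistedPAdicLFunction_of_eigensymbol {N : ℕ}
    (f : CuspForm (CongruenceSubgroup.Gamma0 N) 2) (η : DirichletCharacter ℂ_[p] (p ^ c)) {α : ℂ_[p]}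
    (hα : α ≠ 0) (hαp : α ≠ p) (hαn : ‖α⁻¹‖ ≤ (p : ℝ) ^ (1 / 2 : ℝ)) {Φ : ℚ → ℂ_[p]}
    (hper : ∀ (n : ℕ) (a z : ℤ), Φ ((a : ℚ) / (p : ℚ) ^ n + z) = Φ ((a : ℚ) / (p : ℚ) ^ n))
    (heig : ∀ (n : ℕ) (a : ℤ), ∑ j : Fin p, Φ (((a : ℚ) / (p : ℚ) ^ n + j) / p) = α * Φ ((a : ℚ) / (p : ℚ) ^ n))
    (hdep : ∀ (n : ℕ) (a : ℤ), Φ ((a : ℚ) / (p : ℚ) ^ n) - α / p * Φ (p * ((a : ℚ) / (p : ℚ) ^ n)) =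
      ∑ b : ZMod (p ^ c), η b *
        algebraMap ℚ ℂ_[p] (ratPlusSymbol f ((a : ℚ) / (p : ℚ) ^ n + (b.val : ℚ) / (p : ℚ) ^ c)))
    (hbd : ∃ C : ℝ, ∀ (n : ℕ) (a : ℤ), ‖Φ ((a : ℚ) / (p : ℚ) ^ n)‖ ≤ C) :
    ∃ μ : (n : ℕ) → ZMod (p ^ n) → ℂ_[p], IsUntwistedPAdicLFunction p f η α μ :=
  ⟨fun n s ↦ ∑ᶠ ζ : rootsOfUnity (torsionOrder p) ℤ_[p],
      ∑ b ∈ univ.filter (fun b : ZMod (p ^ (n + cyclotomicExponent p + c)) ↦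
        ZMod.castHom (pow_dvd_pow p (Nat.le_add_right _ c)) (ZMod (p ^ (n + cyclotomicExponent p))) b =
          classOf p n ζ s),
        (η (ZMod.castHom (pow_dvd_pow p (Nat.le_add_left c _)) (ZMod (p ^ c)) b))⁻¹ *
          (α⁻¹ ^ (n + cyclotomicExponent p + c) *
            Φ ((b.val : ℚ) / (p : ℚ) ^ (n + cyclotomicExponent p + c))),
    isUntwistedPAdicLFunction_of_eigensymbol f hα hαp hαn hper heig hdep hbd
      (ν := fun L a ↦ α⁻¹ ^ L * Φ ((a.val : ℚ) / (p : ℚ) ^ L)) (fun _ _ ↦ rfl) (fun _ _ ↦ rfl)⟩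

/-- **EXPLICIT FORMULA — the D1 predicate names exactly the twisted push-forward of `α^{-L}Φ(a/p^L)`.**
Given an untwist eigensymbol `Φ` for `(f, η, α)` as above, EVERY `μ` with
`IsUntwistedPAdicLFunction p f η α μ` is the constructed system: its level-`n` ball value at `γ^sΓ^{pⁿ}` is
`∑_ζ ∑_{b mod p^{n+e₀+c}, b ≡ ζγ^s (p^{n+e₀})} η(b)⁻¹ α^{-(n+e₀+c)} Φ(b/p^{n+e₀+c})` — existence (this file)
plus the tree's Višik uniqueness in the ball-value currency
(`PSGammaUniqueness.eq_of_isUntwistedPAdicLFunction`, Bellaïche Thm. 6.2.13 (i)).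
[cite: Bellaiche2021, Thm. 6.2.13 (i) and Thm. 6.7.9] [cite: MazurTateTeitelbaum1986Invent, §I.13–§I.14] -/
theorem eq_pushforward_of_isUntwistedPAdicLFunction {N : ℕ}
    {f : CuspForm (CongruenceSubgroup.Gamma0 N) 2} {μ : (n : ℕ) → ZMod (p ^ n) → ℂ_[p]}
    (hμ : IsUntwistedPAdicLFunction p f η α μ)
    (hα : α ≠ 0) (hαp : α ≠ p) (hαn : ‖α⁻¹‖ ≤ (p : ℝ) ^ (1 / 2 : ℝ))
    (hper : ∀ (n : ℕ) (a z : ℤ), Φ ((a : ℚ) / (p : ℚ) ^ n + z) = Φ ((a : ℚ) / (p : ℚ) ^ n))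
    (heig : ∀ (n : ℕ) (a : ℤ), ∑ j : Fin p, Φ (((a : ℚ) / (p : ℚ) ^ n + j) / p) = α * Φ ((a : ℚ) / (p : ℚ) ^ n))
    (hdep : ∀ (n : ℕ) (a : ℤ), Φ ((a : ℚ) / (p : ℚ) ^ n) - α / p * Φ (p * ((a : ℚ) / (p : ℚ) ^ n)) =
      ∑ b : ZMod (p ^ c), η b *
        algebraMap ℚ ℂ_[p] (ratPlusSymbol f ((a : ℚ) / (p : ℚ) ^ n + (b.val : ℚ) / (p : ℚ) ^ c)))
    (hbd : ∃ C : ℝ, ∀ (n : ℕ) (a : ℤ), ‖Φ ((a : ℚ) / (p : ℚ) ^ n)‖ ≤ C) (n : ℕ) (s : ZMod (p ^ n)) :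
    μ n s = ∑ᶠ ζ : rootsOfUnity (torsionOrder p) ℤ_[p],
      ∑ b ∈ univ.filter (fun b : ZMod (p ^ (n + cyclotomicExponent p + c)) ↦
        ZMod.castHom (pow_dvd_pow p (Nat.le_add_right _ c)) (ZMod (p ^ (n + cyclotomicExponent p))) b =
          classOf p n ζ s),
        (η (ZMod.castHom (pow_dvd_pow p (Nat.le_add_left c _)) (ZMod (p ^ c)) b))⁻¹ *
          (α⁻¹ ^ (n + cyclotomicExponent p + c) *
            Φ ((b.val : ℚ) / (p : ℚ) ^ (n + cyclotomicExponent p + c))) := by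
  have h := PSGammaUniqueness.eq_of_isUntwistedPAdicLFunction hμ
    (isUntwistedPAdicLFunction_of_eigensymbol f hα hαp hαn hper heig hdep hbd
      (ν := fun L a ↦ α⁻¹ ^ L * Φ ((a.val : ℚ) / (p : ℚ) ^ L)) (fun _ _ ↦ rfl)
      (L := fun n s ↦ ∑ᶠ ζ : rootsOfUnity (torsionOrder p) ℤ_[p],
        ∑ b ∈ univ.filter (fun b : ZMod (p ^ (n + cyclotomicExponent p + c)) ↦
          ZMod.castHom (pow_dvd_pow p (Nat.le_add_right _ c)) (ZMod (p ^ (n + cyclotomicExponent p))) b =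
            classOf p n ζ s),
          (η (ZMod.castHom (pow_dvd_pow p (Nat.le_add_left c _)) (ZMod (p ^ c)) b))⁻¹ *
            (α⁻¹ ^ (n + cyclotomicExponent p + c) *
              Φ ((b.val : ℚ) / (p : ℚ) ^ (n + cyclotomicExponent p + c))))
      (fun _ _ ↦ rfl))
  exact congrFun (congrFun h n) s

/-- **W-level corollary (route `CyclotomicUntwist`, D1 / F1): the principal-series cyclotomic `3`-adic
`L`-function EXISTS as soon as the untwist has an eigensymbol.**  For a Weierstrass curve `W/ℚ` with newform
`f` (`IsNewformOf W f`), a Dirichlet character `η` mod `9` with values in `ℂ₃`, `α ∈ ℂ₃` with `α ≠ 0, 3`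
and `‖α⁻¹‖ ≤ √3` (slope `≤ ½`; intended `α = a₃(g)`, `v₃(α) = ½`), and a function `Φ : ℚ → ℂ₃` satisfying
(S1)–(S4) for `(3, f, η, α)` — in print: `Φ(r) = τ(η){∞, r}⁺_g/Ω⁺_f` for the newform `g` of `f ⊗ η̄` of
level `9M`, `U₃ g = α g` (Atkin–Li 1978 Thm. 3.1; Mazur–Tate–Teitelbaum 1986 §I.14 "`p ∣ N`, `a_p ≠ 0`";
Bellaïche Thm. 6.7.9), whose symbols have bounded denominators (Manin–Drinfeld) — there is `𝓛` with
`IsPSCyclotomicLFunctionOf W η α 𝓛`.  So the route's want F1 («`∃ 𝓛`», `wi-84943`) is, W-level and in the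
tree's existing vocabulary, the existence of such a `Φ`; nothing about `g` beyond (S1)–(S4) is used.
[cite: MazurTateTeitelbaum1986Invent, §I.14 (case p ∣ N, a_p ≠ 0)] [cite: Bellaiche2021, Thm. 6.7.9] [cite: AtkinLi1978, Thm. 3.1] -/
theorem exists_isPSCyclotomicLFunctionOf_of_eigensymbol (W : WeierstrassCurve ℚ) {N : ℕ} [NeZero N]
    (f : CuspForm (CongruenceSubgroup.Gamma0 N) 2) (hf : IsNewformOf W f)
    (η : DirichletCharacter ℂ_[3] (3 ^ 2)) {α : ℂ_[3]} (hα : α ≠ 0) (hα3 : α ≠ 3)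
    (hαn : ‖α⁻¹‖ ≤ (3 : ℝ) ^ (1 / 2 : ℝ)) {Φ : ℚ → ℂ_[3]}
    (hper : ∀ (n : ℕ) (a z : ℤ), Φ ((a : ℚ) / (3 : ℚ) ^ n + z) = Φ ((a : ℚ) / (3 : ℚ) ^ n))
    (heig : ∀ (n : ℕ) (a : ℤ),
      ∑ j : Fin 3, Φ (((a : ℚ) / (3 : ℚ) ^ n + j) / 3) = α * Φ ((a : ℚ) / (3 : ℚ) ^ n))
    (hdep : ∀ (n : ℕ) (a : ℤ), Φ ((a : ℚ) / (3 : ℚ) ^ n) - α / 3 * Φ (3 * ((a : ℚ) / (3 : ℚ) ^ n)) =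
      ∑ b : ZMod (3 ^ 2), η b *
        algebraMap ℚ ℂ_[3] (ratPlusSymbol f ((a : ℚ) / (3 : ℚ) ^ n + (b.val : ℚ) / (3 : ℚ) ^ 2)))
    (hbd : ∃ C : ℝ, ∀ (n : ℕ) (a : ℤ), ‖Φ ((a : ℚ) / (3 : ℚ) ^ n)‖ ≤ C) :
    ∃ 𝓛 : (n : ℕ) → ZMod (3 ^ n) → ℂ_[3], IsPSCyclotomicLFunctionOf W η α 𝓛 := by
  obtain ⟨μ, hμ⟩ := exists_isUntwistedPAdicLFunction_of_eigensymbol (p := 3) f η hα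
    (by exact_mod_cast hα3) (by exact_mod_cast hαn) (by exact_mod_cast hper) (by exact_mod_cast heig)
    (by exact_mod_cast hdep) (by exact_mod_cast hbd)
  exact ⟨μ, N, inferInstance, f, hf, hμ⟩

end Summit.BirchSwinnertonDyer.BirchSwinnertonDyer.Theorems.PSUntwistExistence

end
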